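import Literature.AlgebraicGeometry.Motives.EtaleToProet
import Literature.AlgebraicGeometry.Motives.EtaleToProetHolds
import HarnessLib

/-!
# Finiteness of `Hⁱ(Y_proét, ℤ/n)` for proper `Y` over a separably closed field: decomposition —
# the pro-étale finiteness fact now rests on Milne VI Cor. 2.8 alone

Decomposition record (librarian, mode `fact-decompose`, 2026-08-16) for the XL named fact
`Literature.AlgebraicGeometry.Motives.finite_proetCohomology_zmod_of_isProper`
(`EllAdicCohomologyFiniteness`; Milne, *Étale cohomology*, VI Cor. 2.8 with Bhatt–Scholze 2015,
Cor. 5.1.6 / Lemma 4.2.12: for `K` separably closed, `Y → Spec K` proper, `n ≥ 1` and every `i`,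
`Hⁱ(Y_proét, ℤ/n)` is finite).

**State of the tree.** The seat reduced the fact to the étale-side finiteness and the
Bhatt–Scholze comparison (`finite_proetCohomology_zmod_of_isProper_of_pullback`:
{`finite_etaleCohomology_of_isProper`, `nonempty_addEquiv_sheafH_etaleToProetPullback`}); since then
Bhatt–Scholze Cor. 5.1.6 has been DISCHARGED in the tree
(`nonempty_addEquiv_sheafH_etaleToProetPullback_holds`, `EtaleToProetHolds`, from the Čech
comparison on w-contractible covers and Bhatt–Scholze Thm. 2.3.4 for rings,
`Literature.RingTheory.Etale.exists_indEtale_faithfullyFlat_of_weaklyEtale`, both proved).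

**Decision: SPLIT, one child, an EXISTING named fact + proved glue.**

* child (existing): `finite_etaleCohomology_of_isProper` (`EllAdicComparison`) — Milne VI Cor. 2.8
  (VI Thm. 2.1 applied to `Y → Spec K`): `Hⁱ(Y_ét, M)` is finite for `Y` proper over a separably
  closed field and `M` a finite abelian group (Mathlib's étale site and sheaf cohomology);
* glue (proved): `finite_proetCohomology_zmod_of_isProper_holds_of :
  finite_etaleCohomology_of_isProper → finite_proetCohomology_zmod_of_isProper`.

The child does not restate the parent: it is the finiteness theorem on the ÉTALE site for finite
constant coefficients (proper base change / constructibility, Milne VI §2), with no pro-étale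
site. No definition and no new named fact is introduced.

## References

* J. S. Milne, *Étale Cohomology*, PMS 33, VI Thm. 2.1, VI Cor. 2.8. [Milne2025]
* B. Bhatt, P. Scholze, *The pro-étale topology for schemes*, Astérisque 369 (2015) =
  arXiv:1309.1198, Thm. 2.3.4, Lemma 4.2.12, Cor. 5.1.6. [BhattScholze2015]
-/

universe u

open CategoryTheory Limits Opposite AlgebraicGeometry

noncomputable section

namespace Literature.AlgebraicGeometry.Motives

/-- **Glue of the decomposition of `finite_proetCohomology_zmod_of_isProper`**: the pro-étale
finiteness fact follows from its single child, Milne VI Cor. 2.8 on the étale site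
(`finite_etaleCohomology_of_isProper`), Bhatt–Scholze's comparison `Hⁱ(X_ét, F) ≅ Hⁱ(X_proét, ν*F)`
(Cor. 5.1.6) being the theorem `nonempty_addEquiv_sheafH_etaleToProetPullback_holds` and
`ν*(ℤ/n) = F_{ℤ/n}` (Lemma 4.2.12) being proved in `EtaleToProet` / `ConstantProetSheaf`.
[cite: Milne2025, VI Cor. 2.8] [cite: BhattScholze2015, Cor. 5.1.6 and Lemma 4.2.12] -/
theorem finite_proetCohomology_zmod_of_isProper_holds_of (h : finite_etaleCohomology_of_isProper.{u}) :
    finite_proetCohomology_zmod_of_isProper.{u} :=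
  finite_proetCohomology_zmod_of_isProper_of_pullback h
    nonempty_addEquiv_sheafH_etaleToProetPullback_holds

end Literature.AlgebraicGeometry.Motives

end
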